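import Literature.Topology.FourManifolds.TautFoliationsGluing
import Literature.Topology.FourManifolds.TautFoliationsProductCircle
import HarnessLib

/-!
# The foliation of the open solid torus by meridian discs

Topic `Literature/Topology/FourManifolds`; fact seat
`provefact-Literature.Topology.FourManifolds.Knot.exists_isTaut_hasCompactLeafOfGenus_of_isIntegralSurgery_zero`
(Gabai, J. Differential Geom. 26 (1987), Cor. 8.2, whose printed proof caps off a foliation of the
knot exterior "by discs", p. 525). The second piece of the open gluing that is a Dehn surgery in
the tree (`Literature.Topology.FourManifolds.IsIntegralSurgery`, `TubeNbhd.surgery_exists`) is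
the open solid torus `Literature.Topology.FourManifolds.solidTorus = D̊² × 𝕊¹ ⊆ ℝ² × 𝕊¹`
(`DehnSurgery.lean`). This file foliates it by its meridian discs `D̊² × {v}`, with complete
proofs:

* `Foliation.discChart`, `Foliation.discAtlas` (**definitions**): the one-chart atlas of the
  open unit disc `D̊² = ball 0 1 ⊆ 𝔼 2` (Mathlib's `Homeomorph.unitBall`).
* `Foliation.discTimesCircle` (**definition**): the product foliation of `D̊² × 𝕊¹` by the slices
  `D̊² × {v}` (`Foliation.prodCircle` of `TautFoliationsProductCircle.lean`).
* `Foliation.solidTorusHomeomorph : ↥solidTorus ≃ₜ ↥D̊² × 𝕊¹` and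
  `Foliation.solidTorusDiscs` (**definitions**): the **foliation of the open solid torus by
  meridian discs**, the transport of `discTimesCircle` (`Foliation.map`,
  `TautFoliationsGluing.lean`).
* `leaf_solidTorusDiscs` (**proved**): the leaf through `(w, v)` is the disc `D̊² × {v}`;
  `isTransverselyOriented_solidTorusDiscs`, `isTaut_solidTorusDiscs` (**proved**).
* `Foliation.solidTorusCore` (**definition**) — the core circle `s ↦ (0, e^{i(π/2 - 2πs)})` — is a
  closed transversal meeting every leaf (`isClosedTransversal_solidTorusCore`,
  `exists_solidTorusCore_mem_leaf`, **proved**): "the core of the filling is transverse to `𝓕`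
  and intersects every leaf", Gabai (1987), Cor. 8.2.
* `Foliation.solidTorusDiscChart d` (**definition**), `mem_solidTorusDiscs_atlas_iff`,
  `solidTorusDiscChart_source`, `solidTorusDiscChart_apply_snd` (**proved**): the flow boxes of
  `solidTorusDiscs` are the boxes `(w, v) ↦ (unitBall⁻¹ w, d v)` on `{(w, v) | v ∈ d.source}` for
  the two oriented circle charts `d ∈ circleCharts` (`TautFoliationsProductSpheres.lean`) — the
  description through which a foliation of a knot complement is checked to be longitudinal near
  the knot (`TautFoliationsDehnFilling.lean`).

## References

* D. Gabai, *Foliations and the topology of 3-manifolds. III*, J. Differential Geom. 26 (1987)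
  479–536, Cor. 8.2 and its proof, pp. 524–525 [GabaiJDG1987].
* G. Hector, U. Hirsch, *Introduction to the Geometry of Foliations, Part A* (1986), Ch. II
  2.1.7 (i) (product foliations) [HectorHirsch1986].
* D. Rolfsen, *Knots and Links* (1976), §2.E, §9.F (solid tori, meridian discs) [Rolfsen1976].

## Design notes

* The solid torus is the `Opens` of `DehnSurgery.lean`, as a type `↥solidTorus`; the
  homeomorphism with `↥(ball 0 1) × 𝕊¹` is written out by hand (it is the identity on
  coordinates), so that the core and the leaves have their expected coordinate descriptions
  definitionally.
* Notation `𝔼 n`, `𝕊 n` is local, as in the sibling files.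
-/

open scoped Manifold Topology Real
open Function Set Filter Topology

noncomputable section

namespace Literature.Topology.FourManifolds

/-- Local notation: `𝔼 n` is the model Euclidean space `EuclideanSpace ℝ (Fin n)`. -/
local notation "𝔼 " n:arg => EuclideanSpace ℝ (Fin n)

/-- Local notation: `𝕊 n` is the unit sphere in `EuclideanSpace ℝ (Fin (n + 1))`, the standard
`n`-sphere with its Mathlib manifold structure. -/
local notation "𝕊 " n:arg => (Metric.sphere (0 : EuclideanSpace ℝ (Fin (n + 1))) 1)

namespace Foliation

/-! ## The open unit disc and the product foliation of `D̊² × 𝕊¹` -/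

/-- The open unit disc `D̊² = ball 0 1 ⊆ ℝ²` is preconnected (it is convex). [folklore] -/
theorem preconnectedSpace_unitDisc : PreconnectedSpace ↥(Metric.ball (0 : 𝔼 2) 1) :=
  Subtype.preconnectedSpace (convex_ball (0 : 𝔼 2) 1).isPreconnected

/-- The chart of the open unit disc: Mathlib's homeomorphism `D̊² ≃ₜ ℝ²`
(`Homeomorph.unitBall`), as a partial homeomorphism defined everywhere. [folklore] -/
def discChart : OpenPartialHomeomorph ↥(Metric.ball (0 : 𝔼 2) 1) (𝔼 2) :=
  (Homeomorph.unitBall (E := 𝔼 2)).symm.toOpenPartialHomeomorph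

/-- The one-chart atlas of the open unit disc. [folklore] -/
def discAtlas : Set (OpenPartialHomeomorph ↥(Metric.ball (0 : 𝔼 2) 1) (𝔼 2)) := {discChart}

/-- The chart of the disc atlas is onto `ℝ²`. [folklore] -/
theorem target_eq_of_mem_discAtlas :
    ∀ c ∈ discAtlas, c.target = (univ : Set (𝔼 2)) := by
  rintro c rfl
  exact Homeomorph.toOpenPartialHomeomorph_target _

/-- The chart of the disc atlas is defined everywhere. [folklore] -/
theorem exists_mem_discAtlas_source :
    ∀ a : ↥(Metric.ball (0 : 𝔼 2) 1), ∃ c ∈ discAtlas, a ∈ c.source := fun a ↦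
  ⟨discChart, rfl, by rw [discChart, Homeomorph.toOpenPartialHomeomorph_source]; exact mem_univ a⟩

/-- The **product foliation of `D̊² × 𝕊¹` by the discs `D̊² × {v}`**. [folklore] -/
def discTimesCircle : Foliation (𝔼 2) (↥(Metric.ball (0 : 𝔼 2) 1) × (𝕊 1)) :=
  prodCircle discAtlas target_eq_of_mem_discAtlas exists_mem_discAtlas_source

/-! ## The open solid torus foliated by meridian discs -/

/-- **The open solid torus is `D̊² × 𝕊¹`**: the tautological homeomorphism
`↥solidTorus ≃ₜ ↥(ball 0 1) × 𝕊¹`, `(w, v) ↦ (w, v)`. [folklore] -/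
def solidTorusHomeomorph : ↥solidTorus ≃ₜ ↥(Metric.ball (0 : 𝔼 2) 1) × (𝕊 1) where
  toFun p := (⟨(p : (𝔼 2) × (𝕊 1)).1, mem_ball_zero_iff.2 ((mem_solidTorus_iff _).1 p.2)⟩,
    (p : (𝔼 2) × (𝕊 1)).2)
  invFun q := ⟨((q.1 : 𝔼 2), q.2), (mem_solidTorus_iff _).2 (mem_ball_zero_iff.1 q.1.2)⟩
  left_inv _ := rfl
  right_inv _ := rfl
  continuous_toFun := ((continuous_fst.comp continuous_subtype_val).subtype_mk _).prodMk
    (continuous_snd.comp continuous_subtype_val)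
  continuous_invFun :=
    ((continuous_subtype_val.comp continuous_fst).prodMk continuous_snd).subtype_mk _

/-- The circle coordinate of `solidTorusHomeomorph` is the circle coordinate. [folklore] -/
@[simp] theorem solidTorusHomeomorph_apply_snd (p : ↥solidTorus) :
    (solidTorusHomeomorph p).2 = (p : (𝔼 2) × (𝕊 1)).2 := rfl

/-- The disc coordinate of `solidTorusHomeomorph` is the disc coordinate. [folklore] -/
@[simp] theorem coe_solidTorusHomeomorph_apply_fst (p : ↥solidTorus) :
    ((solidTorusHomeomorph p).1 : 𝔼 2) = (p : (𝔼 2) × (𝕊 1)).1 := rfl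

/-- The inverse of `solidTorusHomeomorph` in coordinates. [folklore] -/
@[simp] theorem coe_solidTorusHomeomorph_symm_apply (q : ↥(Metric.ball (0 : 𝔼 2) 1) × (𝕊 1)) :
    (solidTorusHomeomorph.symm q : (𝔼 2) × (𝕊 1)) = ((q.1 : 𝔼 2), q.2) := rfl

/-- **The foliation of the open solid torus `D̊² × 𝕊¹` by its meridian discs `D̊² × {v}`**
(Rolfsen (1976), §2.E; the foliation by which Gabai (1987), proof of Cor. 8.2, caps off the
leaves of a longitudinal foliation of a knot exterior): the transport of the product foliation
`discTimesCircle` along `solidTorusHomeomorph`. [folklore] -/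
def solidTorusDiscs : Foliation (𝔼 2) ↥solidTorus :=
  discTimesCircle.map solidTorusHomeomorph.symm

/-- **The leaves of `solidTorusDiscs` are the meridian discs**: the leaf through `(w, v)` is
`D̊² × {v}`. [folklore] -/
theorem leaf_solidTorusDiscs (p : ↥solidTorus) :
    solidTorusDiscs.leaf p = {q : ↥solidTorus | (q : (𝔼 2) × (𝕊 1)).2 = (p : (𝔼 2) × (𝕊 1)).2} := by
  haveI := preconnectedSpace_unitDisc
  unfold solidTorusDiscs discTimesCircle
  rw [← solidTorusHomeomorph.symm_apply_apply p, leaf_map,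
    leaf_prodCircle, Homeomorph.image_symm, Homeomorph.symm_apply_apply]
  rfl

/-- The foliation of the solid torus by meridian discs is transversely oriented. [folklore] -/
theorem isTransverselyOriented_solidTorusDiscs : solidTorusDiscs.IsTransverselyOriented :=
  isTransverselyOriented_map _ _ isTransverselyOriented_prodCircle

/-- The foliation of the solid torus by meridian discs is taut. [folklore] -/
theorem isTaut_solidTorusDiscs : solidTorusDiscs.IsTaut :=
  isTaut_map _ _ isTaut_prodCircle

/-- **The core circle** of the open solid torus, as the `1`-periodic loop
`s ↦ (0, e^{i(π/2 - 2πs)})` (`loopPt` of `TautFoliationsProductSpheres.lean`). [folklore] -/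
def solidTorusCore (s : ℝ) : ↥solidTorus :=
  ⟨((0 : 𝔼 2), loopPt s), (mem_solidTorus_iff _).2 (by simp)⟩

/-- The core circle in coordinates. [folklore] -/
@[simp] theorem coe_solidTorusCore (s : ℝ) :
    (solidTorusCore s : (𝔼 2) × (𝕊 1)) = ((0 : 𝔼 2), loopPt s) := rfl

/-- The centre of the open unit disc. [folklore] -/
def discCentre : ↥(Metric.ball (0 : 𝔼 2) 1) := ⟨0, Metric.mem_ball_self one_pos⟩

/-- The core circle is the transport of the slice loop `{0} × 𝕊¹` of `D̊² × 𝕊¹`. [folklore] -/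
theorem solidTorusCore_eq :
    solidTorusCore = solidTorusHomeomorph.symm ∘ fun s ↦ (discCentre, loopPt s) := rfl

/-- **The core circle is a closed transversal** of the foliation by meridian discs ("the core of
the filling is transverse to `𝓕`", Gabai (1987), Cor. 8.2). [folklore] -/
theorem isClosedTransversal_solidTorusCore : solidTorusDiscs.IsClosedTransversal solidTorusCore := by
  rw [solidTorusCore_eq]
  exact (isClosedTransversal_sliceLoop discCentre).map _ _

/-- **The core circle meets every leaf** of the foliation by meridian discs: the leaf through
`(w, v)` contains the core point `(0, v)` ("the core of the filling … intersects every leaf",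
Gabai (1987), Cor. 8.2). [folklore] -/
theorem exists_solidTorusCore_mem_leaf (p : ↥solidTorus) :
    ∃ s, solidTorusCore s ∈ solidTorusDiscs.leaf p := by
  obtain ⟨s, hs⟩ := exists_loopPt_eq (p : (𝔼 2) × (𝕊 1)).2
  refine ⟨s, ?_⟩
  rw [leaf_solidTorusDiscs, mem_setOf_eq, coe_solidTorusCore]
  exact hs

/-! ## The flow boxes of `solidTorusDiscs` -/

/-- **The flow box of the solid torus over a circle chart `d`**: `(w, v) ↦ (unitBall⁻¹ w, d v)`
on `{(w, v) | v ∈ d.source}` (the transport of the product box `discChart.prod d`). [folklore] -/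
def solidTorusDiscChart (d : OpenPartialHomeomorph (𝕊 1) ℝ) :
    OpenPartialHomeomorph ↥solidTorus ((𝔼 2) × ℝ) :=
  (discChart.prod d).lift_openEmbedding solidTorusHomeomorph.symm.isOpenEmbedding

/-- **The atlas of `solidTorusDiscs`** consists of the boxes `solidTorusDiscChart d` for the two
oriented circle charts `d ∈ circleCharts` (`TautFoliationsProductSpheres.lean`). [folklore] -/
theorem mem_solidTorusDiscs_atlas_iff {e : OpenPartialHomeomorph ↥solidTorus ((𝔼 2) × ℝ)} :
    e ∈ solidTorusDiscs.atlas ↔ ∃ d ∈ circleCharts, solidTorusDiscChart d = e := by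
  constructor
  · rintro ⟨e₀, ⟨c, hc, d, hd, rfl⟩, rfl⟩
    obtain rfl : c = discChart := hc
    exact ⟨d, hd, rfl⟩
  · rintro ⟨d, hd, rfl⟩
    exact ⟨_, ⟨discChart, rfl, d, hd, rfl⟩, rfl⟩

/-- The boxes `solidTorusDiscChart d`, `d ∈ circleCharts`, are flow boxes of `solidTorusDiscs`.
[folklore] -/
theorem solidTorusDiscChart_mem_atlas {d : OpenPartialHomeomorph (𝕊 1) ℝ} (hd : d ∈ circleCharts) :
    solidTorusDiscChart d ∈ solidTorusDiscs.atlas :=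
  mem_solidTorusDiscs_atlas_iff.2 ⟨d, hd, rfl⟩

/-- The source of the flow box over `d` is `{(w, v) | v ∈ d.source}`. [folklore] -/
theorem solidTorusDiscChart_source (d : OpenPartialHomeomorph (𝕊 1) ℝ) :
    (solidTorusDiscChart d).source = {q : ↥solidTorus | (q : (𝔼 2) × (𝕊 1)).2 ∈ d.source} := by
  rw [solidTorusDiscChart, OpenPartialHomeomorph.lift_openEmbedding_source, Homeomorph.image_symm,
    OpenPartialHomeomorph.prod_source, discChart, Homeomorph.toOpenPartialHomeomorph_source]
  ext q
  simp only [mem_preimage, mem_prod, mem_univ, true_and, mem_setOf_eq, solidTorusHomeomorph_apply_snd]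

/-- **The height in the flow box over `d` is the circle coordinate read in `d`**:
`(w, v) ↦ d v`. [folklore] -/
theorem solidTorusDiscChart_apply_snd (d : OpenPartialHomeomorph (𝕊 1) ℝ) (q : ↥solidTorus) :
    (solidTorusDiscChart d q).2 = d (q : (𝔼 2) × (𝕊 1)).2 := by
  conv_lhs => rw [← solidTorusHomeomorph.symm_apply_apply q]
  rw [solidTorusDiscChart, OpenPartialHomeomorph.lift_openEmbedding_apply,
    OpenPartialHomeomorph.prod_apply]
  rfl

end Foliation

end Literature.Topology.FourManifolds
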